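import Literature.NumberTheory.LFunctions.WeilTwoPrimeOddMarginEBase
import Literature.NumberTheory.LFunctions.WeilTwoPrimeOddMarginEDataDn2
import Literature.NumberTheory.LFunctions.WeilBlockRowsPZ
import HarnessLib

/-!
# Two-prime odd-margin certificate E: the Bessel block claim `Hp = C H Cᵀ`, rows 60–64

`WeilCert.checkHpRow` for rows 60–64 of certificate E (the exact Legendre cancellation `C H Cᵀ = diag(2a₀/(4i+3))`), by `decide +kernel`. Pure proof file.
-/

noncomputable section

namespace Literature.NumberTheory.LFunctions

set_option maxHeartbeats 0 in
/-- Row 60 of `C H Cᵀ` is row 60 of `Hp` (certificate E). [folklore] -/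
theorem checkHpRow1_60_weilCert23E : weilCert23EBase.checkHpRow weilCert23EHp 1 60 = true := by
  decide +kernel

set_option maxHeartbeats 0 in
/-- Row 61 of `C H Cᵀ` is row 61 of `Hp` (certificate E). [folklore] -/
theorem checkHpRow1_61_weilCert23E : weilCert23EBase.checkHpRow weilCert23EHp 1 61 = true := by
  decide +kernel

set_option maxHeartbeats 0 in
/-- Row 62 of `C H Cᵀ` is row 62 of `Hp` (certificate E). [folklore] -/
theorem checkHpRow1_62_weilCert23E : weilCert23EBase.checkHpRow weilCert23EHp 1 62 = true := by
  decide +kernel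

set_option maxHeartbeats 0 in
/-- Row 63 of `C H Cᵀ` is row 63 of `Hp` (certificate E). [folklore] -/
theorem checkHpRow1_63_weilCert23E : weilCert23EBase.checkHpRow weilCert23EHp 1 63 = true := by
  decide +kernel

set_option maxHeartbeats 0 in
/-- Row 64 of `C H Cᵀ` is row 64 of `Hp` (certificate E). [folklore] -/
theorem checkHpRow1_64_weilCert23E : weilCert23EBase.checkHpRow weilCert23EHp 1 64 = true := by
  decide +kernel


end Literature.NumberTheory.LFunctions
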